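import Literature.NumberTheory.EllipticCurves.TakahashiRankOneOfEichlerSelberg
import Literature.NumberTheory.EllipticCurves.HeckeFixedPointCount
import Literature.NumberTheory.Automorphic.EichlerEmbeddingLocalLevel
import HarnessLib

/-!
# Stub ideas k3 — GENERATION 6 (FAMILY 3, probe the extremes / perturb the proved neighbour) for
# `stub_takahashi` (`takahashi2001_thm_2_3_of_coprime`), crux `DefiniteRTControlPrime`, route `DefiniteXi`

Scratch sketch: elaboration sanity of the NEW helper-lemma signatures (no proofs claimed except the
ones marked PROVED).  Gens 1–5 retained BY REFERENCE (`StubIdeas3Sketch`, `…3g2…`, `…3g3…`, `…3g4…`,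
`…3g5Sketch`).

Gen-6 content = the Brandt side of gen-2's `L3 = LocalChainIdentityPow` at prime-power level, the one
M-leaf of the depth path that gens 2–5 never typed (gen-5 typed only O3, the fixed-point / density side):

* **Plan A (top) — Voight–Hijikata normal form.**  For a level-`q^e` matrix model of `O_(q)` the local
  embedding number of `B = ℤ[σ₀] ∋ γ` is EXPLICIT in root counts of `f_B = X² - t_B X + n_B`:
  `m_q(B) = #{x ∈ ℤ/q^e : f_B(x) = 0} + [q ∣ d_B] · #img({x ∈ ℤ/q^{e+1} : f_B(x) = 0} → ℤ/q^e)`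
  (Voight, *Quaternion algebras*, Prop. 30.6.12 ← Hijikata 1974 Thm. 2.3; valid for ALL `q`, incl. 2),
  via normalized matrices `N_x = (x 1; -f(x) t-x)` and their Atkin–Lehner conjugates (L. 30.6.3, 30.6.9).
  Then L3 is a finite identity of root counts along the `q`-chain (`chain_identity_levelPow`, whose
  `e = 1` case is the tree's `chain_identity_level`), the density side being gen-5 H5.0/H5.3.
* **Plan B — structural regrouping** (gen-4 `OrbitalRegroupingPow`, uniform, no case analysis):
  port `EichlerEmbeddingLocalLevel` from level `q` to `q^e` (lattice pairs `L ⊋ L' ⊇ q^e L`,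
  `L/L'` cyclic) and count `Rˣ`-orbits of `γ`-stable lines of `ℙ¹(R/q^e R)` by depth (formula (★)).

Both formulas were cross-certified by brute force in this session (`scratch/g6_crosscheck.py`):
(★) = Prop. 30.6.12 on 918 local orders (`q = 2, e ≤ 4; q = 3, e ≤ 3; q = 5, e ≤ 2`, all `(t, n)` in a
box, split / inert / ramified / non-maximal), and the chain identity (Voight count vs fixed lines,
`chainW`-weighted) on 440 chains (`q = 2, e ≤ 6, a ≤ 4` over every 2-adic maximal type; `q = 3, 5, 7`),
0 mismatches (independent of gen-2 C4's 30 000 chains).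
-/

noncomputable section

open scoped BigOperators Matrix Pointwise
open Finset

set_option linter.dupNamespace false
set_option linter.unusedVariables false

universe u

namespace Summit.ABC.ABC.Cruxes.DefiniteRTControlPrime.StubIdeas3g6

open Literature.NumberTheory.EllipticCurves
open Literature.NumberTheory.EllipticCurves.ModularForms
open Literature.NumberTheory.Automorphic Literature.NumberTheory.Automorphic.Brandt
open Literature.NumberTheory.Automorphic.HeckeTraceFormulaGL2Level
open Literature.NumberTheory.QuadraticFields.PadicQuadratic

/-! ## Plan A — Voight–Hijikata normal form (matrix currency, no lattices) -/

section PlanA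

variable {q : ℕ} [hq : Fact q.Prime]

/-- The standard local Eichler order of level `q^e`, `(ℤ_q ℤ_q; q^e ℤ_q ℤ_q)`, as a set of matrices. -/
def eichlerSet (q : ℕ) [Fact q.Prime] (e : ℕ) : Set (Matrix (Fin 2) (Fin 2) ℚ_[q]) :=
  {A | (∀ i j, ‖A i j‖ ≤ 1) ∧ ‖A 1 0‖ ≤ (q : ℝ) ^ (-(e : ℤ))}

/-- `A ∈ O` generates an OPTIMALLY embedded order `ℤ_q[A]` (`(A - z)/q ∉ O` for all `z ∈ ℤ_q`):
"at least one of `b`, `c/q^e`, `a - d` is a unit" (Voight, proof of L. 30.6.3). -/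
def IsOptimalMat (q : ℕ) [Fact q.Prime] (e : ℕ) (A : Matrix (Fin 2) (Fin 2) ℚ_[q]) : Prop :=
  A ∈ eichlerSet q e ∧
    ¬ (‖A 0 1‖ < 1 ∧ ‖A 0 0 - A 1 1‖ < 1 ∧ ‖A 1 0‖ ≤ (q : ℝ) ^ (-((e + 1 : ℕ) : ℤ)))

/-- Conjugacy under the unit group of the standard Eichler order. -/
def EichConj (q : ℕ) [Fact q.Prime] (e : ℕ) (A A' : Matrix (Fin 2) (Fin 2) ℚ_[q]) : Prop :=
  ∃ μ : Matrix (Fin 2) (Fin 2) ℚ_[q], μ ∈ eichlerSet q e ∧ IsUnit μ.det ∧ μ⁻¹ ∈ eichlerSet q e ∧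
    A' = μ⁻¹ * A * μ

/-- Voight's normalized matrix `N_x = (x 1; -f(x) t-x)`, `f = X² - tX + n` (Def. 30.6.8). -/
def normMat (t n x : ℚ_[q]) : Matrix (Fin 2) (Fin 2) ℚ_[q] := !![x, 1; -(x ^ 2 - t * x + n), t - x]

/-- The Atkin–Lehner element `ϖ = (0 1; q^e 0)` of the normalizer (30.6.1). -/
def varpi (q : ℕ) [Fact q.Prime] (e : ℕ) : Matrix (Fin 2) (Fin 2) ℚ_[q] := !![0, 1; (q : ℚ_[q]) ^ e, 0]

/-- `#img({y mod q^{e+1} : y² - ty + n = 0} → ℤ/q^e)` — the second term of Prop. 30.6.12. -/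
def liftRootCount (q : ℕ) [Fact q.Prime] (e : ℕ) (t n : ℤ) : ℕ := by
  classical
  exact ((Finset.univ.filter fun y : ZMod (q ^ (e + 1)) =>
      y ^ 2 - (t : ZMod (q ^ (e + 1))) * y + (n : ZMod (q ^ (e + 1))) = 0).image
    (ZMod.castHom (pow_dvd_pow q (Nat.le_succ e)) (ZMod (q ^ e)))).card

/-- **Hypotheses of the local count at level `q^e`** = the tree's `LevelHyp` with `hO` at exponent `e`
(the model exists: gen-2 `existsLevelPowModel_holds`, from `IsEichlerOrder.exists_conjUnit_localAt_iff_eichler`). -/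
structure LevelPowHyp {D : Type u} [Ring D] [Algebra ℚ D] (Φ : D →ₐ[ℚ] Matrix (Fin 2) (Fin 2) ℚ_[q])
    (O : Submodule ℤ D) (γ : D) (B : Submodule ℤ D) (σ₀ : D) (r₀ : ℚ) (m : ℕ) (tB nB : ℤ) (e : ℕ) :
    Prop where
  hD : ∀ x : D, x ≠ 0 → IsUnit x
  hγ : γ ∉ (⊥ : Subalgebra ℚ D)
  he : 1 ≤ e
  hO : ∀ y : D, y ∈ localAt q O ↔ (∀ i j, ‖Φ y i j‖ ≤ 1) ∧ ‖Φ y 1 0‖ ≤ (q : ℝ) ^ (-(e : ℤ))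
  hO1 : (1 : D) ∈ O
  hOmul : ∀ a ∈ O, ∀ b ∈ O, a * b ∈ O
  hB : IsQuadOrder γ B
  hm : m ≠ 0
  hσ₀ : σ₀ = algebraMap ℚ D r₀ + (m : ℚ)⁻¹ • γ
  hBσ : ∀ b : D, b ∈ B ↔ ∃ u v : ℤ, b = algebraMap ℚ D u + v • σ₀
  hsq : σ₀ * σ₀ = (tB : ℚ) • σ₀ - algebraMap ℚ D nB

variable {D : Type u} [Ring D] [Algebra ℚ D] [IsQuaternionAlgebra ℚ D]
  {Φ : D →ₐ[ℚ] Matrix (Fin 2) (Fin 2) ℚ_[q]} {O : Submodule ℤ D} {γ : D} {B : Submodule ℤ D}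
  {σ₀ : D} {r₀ : ℚ} {m : ℕ} {tB nB : ℤ} {e : ℕ}

/-- H6.A1a (M−) **dictionary, membership**: `x O_(q)` has optimal order `⊇ B_(q)` / `= B_(q)` iff the matrix
`A_x = Φ(x)⁻¹ Φ(σ₀) Φ(x)` lies in the standard order / is optimal in it. -/
theorem mem_localIdeals_iff_isOptimalMat (H : LevelPowHyp Φ O γ B σ₀ r₀ m tB nB e) (x : Dˣ) :
    x • localAt q O ∈ localIdeals O γ B q ↔
      IsOptimalMat q e (Φ ((x⁻¹ : Dˣ) : D) * Φ σ₀ * Φ (x : D)) := by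
  sorry

/-- H6.A1b (M) **dictionary, classes**: two local ideals with optimal order `B_(q)` are equivalent
(`x' O_(q) = c x O_(q)`, `c ∈ ℚ(γ)ˣ`) iff their matrices are conjugate under the Eichler unit group
(`⇐` by density of `ℚ(γ)` in `ℚ_q(γ)`: the stabiliser of `x O_(q)` in `ℚ_q(γ)ˣ` is open). -/
theorem localClass_mk_eq_iff_eichConj (H : LevelPowHyp Φ O γ B σ₀ r₀ m tB nB e) {x x' : Dˣ}
    (hx : x • localAt q O ∈ localIdeals O γ B q) (hx' : x' • localAt q O ∈ localIdeals O γ B q) :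
    LocalClass.mk ⟨x • localAt q O, hx⟩ = LocalClass.mk ⟨x' • localAt q O, hx'⟩ ↔
      EichConj q e (Φ ((x⁻¹ : Dˣ) : D) * Φ σ₀ * Φ (x : D)) (Φ ((x'⁻¹ : Dˣ) : D) * Φ σ₀ * Φ (x' : D)) := by
  sorry

/-- H6.A1c (M−) **dictionary, surjectivity**: every optimal matrix with the characteristic polynomial of
`σ₀` is Eichler-conjugate to some `A_x`, `x ∈ Dˣ` global (rational canonical form by a cyclic vector,
`exists_vdet_mulVec_ne_zero`, then `AlgHom.exists_norm_sub_le` to replace `g ∈ GL₂(ℚ_q)` by `Φ(x)`). -/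
theorem exists_units_eichConj (H : LevelPowHyp Φ O γ B σ₀ r₀ m tB nB e)
    {A : Matrix (Fin 2) (Fin 2) ℚ_[q]} (hA : IsOptimalMat q e A)
    (hchar : A * A - ((tB : ℚ) : ℚ_[q]) • A + ((nB : ℚ) : ℚ_[q]) • (1 : Matrix (Fin 2) (Fin 2) ℚ_[q]) = 0) :
    ∃ x : Dˣ, EichConj q e A (Φ ((x⁻¹ : Dˣ) : D) * Φ σ₀ * Φ (x : D)) := by
  sorry

/-- H6.A2 (M−) **normal form** [Voight L. 30.6.3]: an optimal `A` with `A² - tA + n = 0` is Eichler-conjugate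
to `N_x` or to `ϖ⁻¹ N_x ϖ` for some `x ∈ ℤ_q` with `f(x) ≡ 0 (mod q^e)` (three explicit conjugations). -/
theorem eichConj_normMat_or_varpi (e : ℕ) {t n : ℚ_[q]} {A : Matrix (Fin 2) (Fin 2) ℚ_[q]}
    (hA : IsOptimalMat q e A) (hchar : A * A - t • A + n • (1 : Matrix (Fin 2) (Fin 2) ℚ_[q]) = 0) :
    ∃ x : ℚ_[q], ‖x‖ ≤ 1 ∧ ‖x ^ 2 - t * x + n‖ ≤ (q : ℝ) ^ (-(e : ℤ)) ∧
      (EichConj q e A (normMat t n x) ∨ EichConj q e A ((varpi q e)⁻¹ * normMat t n x * varpi q e)) := by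
  sorry

/-- H6.A3 (S–M) [Voight L. 30.6.9(a)]: `N_x ~ N_{x'}` iff `x ≡ x' (mod q^e)` (reduce modulo `q^e M₂(ℤ_q)`:
`O/q^e M₂` is upper triangular, diagonal entries are class functions; converse `μ = (1 0; x'-x 1)`). -/
theorem eichConj_normMat_iff {e : ℕ} (he : 1 ≤ e) {t n x x' : ℚ_[q]} (ht : ‖t‖ ≤ 1) (hn : ‖n‖ ≤ 1)
    (hx : ‖x‖ ≤ 1) (hx' : ‖x'‖ ≤ 1) (hfx : ‖x ^ 2 - t * x + n‖ ≤ (q : ℝ) ^ (-(e : ℤ)))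
    (hfx' : ‖x' ^ 2 - t * x' + n‖ ≤ (q : ℝ) ^ (-(e : ℤ))) :
    EichConj q e (normMat t n x) (normMat t n x') ↔ ‖x - x'‖ ≤ (q : ℝ) ^ (-(e : ℤ)) := by
  sorry

/-- H6.A4 (M) [Voight L. 30.6.9(b)(c)]: `ϖ⁻¹ N_x ϖ ~ N_{x'}` iff `x' ≡ t - x (mod q^e)` AND (`d = t² - 4n` is a
unit OR `f(x) ≢ 0 (mod q^{e+1})`); when `q ∣ d` the latter condition depends on `x mod q^e` only
(`f(x + q^e u) ≡ f(x) (mod q^{e+1})` since `q ∣ 2x - t`). The `(c) ⇒` direction is the subtle one. -/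
theorem eichConj_varpi_normMat_iff {e : ℕ} (he : 1 ≤ e) {t n x x' : ℚ_[q]} (ht : ‖t‖ ≤ 1) (hn : ‖n‖ ≤ 1)
    (hx : ‖x‖ ≤ 1) (hx' : ‖x'‖ ≤ 1) (hfx : ‖x ^ 2 - t * x + n‖ ≤ (q : ℝ) ^ (-(e : ℤ)))
    (hfx' : ‖x' ^ 2 - t * x' + n‖ ≤ (q : ℝ) ^ (-(e : ℤ))) :
    EichConj q e ((varpi q e)⁻¹ * normMat t n x * varpi q e) (normMat t n x') ↔
      ‖x' - (t - x)‖ ≤ (q : ℝ) ^ (-(e : ℤ)) ∧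
        (‖t ^ 2 - 4 * n‖ = 1 ∨ ¬ ‖x ^ 2 - t * x + n‖ ≤ (q : ℝ) ^ (-((e + 1 : ℕ) : ℤ))) := by
  sorry

/-- H6.A5 (S given A1–A4; the `Sum.elim` bookkeeping of the tree's `LevelHyp.localEmbeddingNumber_eq`)
**Voight Prop. 30.6.12 in the tree's currency**:
`m_q(B) = #{x ∈ ℤ/q^e : x² - t_B x + n_B = 0} + [q ∣ t_B² - 4 n_B] · liftRootCount`.
At `e = 1` this is `ρ_q(B) + [B_q not maximal]` (the tree's level-`q` count). -/
theorem localEmbeddingNumber_eq_rootCount (H : LevelPowHyp Φ O γ B σ₀ r₀ m tB nB e) :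
    localEmbeddingNumber O γ B q =
      rootCount (ZMod (q ^ e)) (tB : ZMod (q ^ e)) (nB : ZMod (q ^ e)) +
        (if (q : ℤ) ∣ tB ^ 2 - 4 * nB then liftRootCount q e tB nB else 0) := by
  sorry

/-! ### Root-count recursions along a `q`-chain (all S; `σ_f = q σ_{fq} + c`) -/

/-- H6.A6i (S) index-`q` step: roots of `f_{B_f}` mod `q^{s+2}` are `q y + c`, `y` a root of `f_{B_{fq}}` mod `q^s`
read mod `q^{s+1}`: `N_f(s+2) = q · N_{fq}(s)`. -/
theorem rootCount_step {t : ℤ} {n : ℕ} (h : t ^ 2 < 4 * n) (hq : q.Prime) {f : ℕ}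
    (hf : f ∈ ellipticConductors t n) (hfq : f * q ∈ ellipticConductors t n) (s : ℕ) :
    rootCount (ZMod (q ^ (s + 2))) (tOf t n f : ZMod _) (nOf t n f : ZMod _) =
      q * rootCount (ZMod (q ^ s)) (tOf t n (f * q) : ZMod _) (nOf t n (f * q) : ZMod _) := by
  sorry

/-- H6.A6ii (S) bridge to the tree's `rho` at `s = 1`. -/
theorem rootCount_zmod_eq_rho (hq : q.Prime) (t' n' : ℤ) :
    rootCount (ZMod q) (t' : ZMod q) (n' : ZMod q) = rho q t' n' := by
  sorry

/-- H6.A6iii (S–M, Hensel; at `q = 2` a unit discriminant forces `t'` odd, so roots are simple)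
unramified top of the chain: `N(s) = ρ` for all `s ≥ 1`. -/
theorem rootCount_eq_rho_of_not_dvd_disc (hq : q.Prime) {t' n' : ℤ} (hd : ¬ (q : ℤ) ∣ t' ^ 2 - 4 * n')
    {s : ℕ} (hs : 1 ≤ s) :
    rootCount (ZMod (q ^ s)) (t' : ZMod _) (n' : ZMod _) = rho q t' n' := by
  sorry

/-- H6.A6iv (S) ramified MAXIMAL top: no roots mod `q²` (a root `x` mod `q²` with `q ∣ d` makes `(σ - x)/q`
integral — Voight L. 30.6.16; works at `q = 2` too), hence `N(s) = 0` for `s ≥ 2` and `liftRootCount = 0`. -/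
theorem rootCount_eq_zero_of_ramified_maximal (hq : q.Prime) {t' n' : ℤ} (hd : (q : ℤ) ∣ t' ^ 2 - 4 * n')
    (hmax : ¬ ∃ c : ℤ, (q : ℤ) ^ 2 ∣ c ^ 2 - t' * c + n' ∧ (q : ℤ) ∣ 2 * c - t') {s : ℕ} (hs : 2 ≤ s) :
    rootCount (ZMod (q ^ s)) (t' : ZMod _) (n' : ZMod _) = 0 := by
  sorry

/-- H6.A6v (S) when `q ∣ d` every root class mod `q^e` has exactly `q` or `0` lifts mod `q^{e+1}`:
`q · liftRootCount = N(e+1)`. -/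
theorem mul_liftRootCount_eq (hq : q.Prime) {e : ℕ} (he : 1 ≤ e) {t' n' : ℤ}
    (hd : (q : ℤ) ∣ t' ^ 2 - 4 * n') :
    q * liftRootCount q e t' n' = rootCount (ZMod (q ^ (e + 1))) (t' : ZMod _) (n' : ZMod _) := by
  sorry

/-! ### The chain identity at level `q^e` (pure arithmetic; `e = 1` is the tree's `chain_identity_level`) -/

/-- Root counts `N(k, s)` of the order at depth `k` below the top of the chain, from the top counts `ν`. -/
def chainN (q : ℚ) (ν : ℕ → ℚ) : ℕ → ℕ → ℚ
  | 0, s => ν s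
  | _ + 1, 0 => 1
  | _ + 1, 1 => 1
  | k + 1, s + 2 => q * chainN q ν k s

/-- Brandt local factor of the depth-`k` order (Prop. 30.6.12 with A6v): `N(k,e) + [k ≠ 0 ∨ ram] N(k,e+1)/q`. -/
def chainM (q : ℚ) (ν : ℕ → ℚ) (ram : Bool) (e k : ℕ) : ℚ :=
  chainN q ν k e + (if k = 0 ∧ ram = false then 0 else chainN q ν k (e + 1) / q)

/-- CO density of the order at depth `k`, distance `j` from the bottom (gen-5 H5.0/H5.3):
`ψ(q^e)` if `j ≥ e`, else `q^j N(k, e - j)`. -/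
def chainMu (q : ℚ) (ν : ℕ → ℚ) (e j k : ℕ) : ℚ :=
  if e ≤ j then (q + 1) * q ^ (e - 1) else q ^ j * chainN q ν k (e - j)

/-- H6.A8u (M) **chain identity, unramified top** (`ν ≡ X ∈ {0, 2}` for `s ≥ 1`). Proof hint: induction
`e ↦ e - 2` (`chainN (k+1) (s+2) = q · chainN k s` shifts the chain), bases `e = 1` (= `chain_identity_level`)
and `e = 2`. Certified: 440 chains, `scratch/g6_crosscheck.py C`. -/
theorem chain_identity_levelPow_unram (q X : ℚ) (hX : X = 0 ∨ X = 2) (ν : ℕ → ℚ) (hν0 : ν 0 = 1)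
    (hν : ∀ s, 1 ≤ s → ν s = X) {e : ℕ} (he : 1 ≤ e) (a : ℕ) :
    ∑ k ∈ range (a + 1), chainW q (q + 1 - X) k * chainM q ν false e k =
      ∑ k ∈ range (a + 1), chainW q (q + 1 - X) k * chainMu q ν e (a - k) k := by
  sorry

/-- H6.A8r (M) **chain identity, ramified top** (`ν 1 = 1`, `ν s = 0` for `s ≥ 2`, `X = 1`). -/
theorem chain_identity_levelPow_ram (q : ℚ) (ν : ℕ → ℚ) (hν0 : ν 0 = 1) (hν1 : ν 1 = 1)
    (hν : ∀ s, 2 ≤ s → ν s = 0) {e : ℕ} (he : 1 ≤ e) (a : ℕ) :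
    ∑ k ∈ range (a + 1), chainW q (q + 1 - 1) k * chainM q ν true e k =
      ∑ k ∈ range (a + 1), chainW q (q + 1 - 1) k * chainMu q ν e (a - k) k := by
  sorry

/-- Kernel sanity of the definitions at the smallest new case `q = 2, e = 2, a = 1`, inert top (`X = 0`):
LHS `= 0 + 3·(2 + 0) = 6`, RHS `= 2·0 + 3·2 = 6`. PROVED. -/
example : (∑ k ∈ range 2, chainW 2 (2 + 1 - 0) k * chainM 2 (fun s => if s = 0 then 1 else 0) false 2 k) =
    ∑ k ∈ range 2, chainW 2 (2 + 1 - 0) k * chainMu 2 (fun s => if s = 0 then 1 else 0) 2 (1 - k) k := by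
  simp [Finset.sum_range_succ, chainW, chainM, chainMu, chainN]

end PlanA

/-! ## Plan B — structural regrouping (gen-4 `OrbitalRegroupingPow`): level-`q^e` port of
`EichlerEmbeddingLocalLevel` + orbit counting.  Derivation of (★): classes of pairs `(L, L')`, `L ⊋ L' ⊇ q^e L`
cyclic, modulo `K_qˣ`; normalise `L = R_i` (its multiplier ring, `exists_normalForm`), residual freedom `R_iˣ`;
`L'` ↔ a line of `R_i/q^e R_i ≅ (ℤ/q^e)²`; optimal order `R_i ∩ mult L' = ℤ_q + q^d R_i`, `d` = depth of the
line (least `d` with `q^d σ_i ℓ ⊆ ℓ`); the `R_iˣ`-orbit of a depth-`d` line has `[R_iˣ : R_{i+d}ˣ]` lines.  Hence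
(★) `m_q(B) = Σ_{d ≤ e, R ⊇ B of index q^d} #{depth-d unimodular v ∈ (R/q^e)²} / (φ(q^e) [Rˣ : Bˣ])`,
and the chain sum of (★) against `hw` (`Chain.hw_eq`: `hw(R_{i+d}) = hw(R_i)·[R_iˣ:R_{i+d}ˣ]`) regroups into
`Σ_i hw(R_i) #Fix(γ | ℙ¹(R_i/q^e))` = RHS of `OrbitalRegroupingPow`. -/

section PlanB

variable {q : ℕ} [hq : Fact q.Prime]

/-- `D_{q^e} = diag(1, q^e)`. -/
def diagQPow (q : ℕ) [Fact q.Prime] (e : ℕ) : Matrix (Fin 2) (Fin 2) ℚ_[q] :=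
  !![(1 : ℚ_[q]), 0; 0, (q : ℚ_[q]) ^ e]

/-- PROVED. -/
theorem isUnit_det_diagQPow (e : ℕ) : IsUnit (diagQPow q e).det := by
  rw [isUnit_iff_ne_zero, diagQPow, Matrix.det_fin_two_of]
  simp [hq.out.ne_zero]

/-- H6.P1 (S, port of `eichler_iff_colLatt` with `Padic.integral_and_diag_conj_integral_iff` at `d = e`)
**the level-`q^e` Eichler condition in lattice form**. -/
theorem eichler_iff_colLatt_pow (e : ℕ) {g : Matrix (Fin 2) (Fin 2) ℚ_[q]} (hg : IsUnit g.det)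
    (g' : Matrix (Fin 2) (Fin 2) ℚ_[q]) :
    ((∀ i j, ‖(g⁻¹ * g') i j‖ ≤ 1) ∧ ‖(g⁻¹ * g') 1 0‖ ≤ (q : ℝ) ^ (-(e : ℤ))) ↔
      colLatt g' ⊆ colLatt g ∧ colLatt (g' * diagQPow q e) ⊆ colLatt (g * diagQPow q e) := by
  sorry

/-- H6.P2 (S, port of `mem_smul_localAt_iff_level`) `y ∈ x O_(q)` in lattice-pair form at level `q^e`. -/
theorem mem_smul_localAt_iff_levelPow {D : Type u} [Ring D] [Algebra ℚ D]
    (Φ : D →ₐ[ℚ] Matrix (Fin 2) (Fin 2) ℚ_[q]) {O : Submodule ℤ D} {e : ℕ}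
    (hO : ∀ y : D, y ∈ localAt q O ↔ (∀ i j, ‖Φ y i j‖ ≤ 1) ∧ ‖Φ y 1 0‖ ≤ (q : ℝ) ^ (-(e : ℤ)))
    (x : Dˣ) (y : D) :
    y ∈ x • localAt q O ↔ colLatt (Φ y) ⊆ colLatt (Φ (x : D)) ∧
      colLatt (Φ y * diagQPow q e) ⊆ colLatt (Φ (x : D) * diagQPow q e) := by
  sorry

/-- H6.B1 (M−, port of `latt_smul_eq_cases`) **the `ψ(q^e)` cyclic sublattices of cotype `q^e`**:
if `[α, β] = [1, σ]` then `[α, q^e β] = [σ + k, q^e]` or `[1 + qkσ, q^e σ]` for some `k ∈ ℤ_q`. -/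
theorem latt_smul_pow_eq_cases {a b : ℚ_[q]} {σ α β : QuadraticAlgebra ℚ_[q] a b} (hσ : σ.im ≠ 0) (e : ℕ)
    (h : latt α β = latt 1 σ) :
    (∃ k : ℚ_[q], ‖k‖ ≤ 1 ∧
        latt α (((q : ℚ_[q]) ^ e) • β) = latt (σ + k • 1) (((q : ℚ_[q]) ^ e) • (1 : QuadraticAlgebra ℚ_[q] a b))) ∨
      ∃ k : ℚ_[q], ‖k‖ ≤ 1 ∧
        latt α (((q : ℚ_[q]) ^ e) • β) = latt (1 + ((q : ℚ_[q]) * k) • σ) (((q : ℚ_[q]) ^ e) • σ) := by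
  sorry

/-- Unimodular vectors of `(ℤ/N)²` of depth `≤ d'` for the integer matrix `S` (`d' • S v ∈ line(v)`);
`fixedUnimodular N A` of gen-4/5 is `depthLE N A 1`. -/
def depthLE (N : ℕ) [NeZero N] (S : Matrix (Fin 2) (Fin 2) ℤ) (d' : ℕ) : Finset (Fin 2 → ZMod N) := by
  classical
  exact Finset.univ.filter fun v =>
    (IsUnit (v 0) ∨ IsUnit (v 1)) ∧ ∃ c : ZMod N, ((d' : ℤ) • S).map (Int.cast : ℤ → ZMod N) *ᵥ v = c • v

/-- The matrix of `σ_f` on the basis `(1, σ_f)` of `B_f` (so `gammaMatrix t n f = f • sigmaMatrix - shift • 1`). -/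
def sigmaMatrix (t : ℤ) (n f : ℕ) : Matrix (Fin 2) (Fin 2) ℤ := !![0, -(nOf t n f); 1, tOf t n f]

/-- The coefficient pairs `(x, y)` of the units `x + y σ̄` of `(ℤ/N)[σ̄]` (`= (R/N R)ˣ`). -/
def unitPairs (N : ℕ) [NeZero N] (S : Matrix (Fin 2) (Fin 2) ℤ) : Finset (ZMod N × ZMod N) := by
  classical
  exact Finset.univ.filter fun xy =>
    IsUnit (xy.1 • (1 : Matrix (Fin 2) (Fin 2) (ZMod N)) + xy.2 • S.map (Int.cast : ℤ → ZMod N)).det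

/-- H6.C2 (S–M) `#(R/q^e R)ˣ = q^{2(e-1)} (q - 1) (q + 1 - ρ_q(R))` (`R/q ≅ 𝔽_{q²}, 𝔽_q², 𝔽_q[ε]`). -/
theorem card_unitPairs {e : ℕ} (he : 1 ≤ e) (t : ℤ) (n f : ℕ) (h : t ^ 2 < 4 * n)
    (hf : f ∈ ellipticConductors t n) :
    haveI : NeZero (q ^ e) := ⟨pow_ne_zero _ hq.out.ne_zero⟩
    (unitPairs (q ^ e) (sigmaMatrix t n f)).card =
      q ^ (2 * (e - 1)) * (q - 1) * (q + 1 - rho q (tOf t n f) (nOf t n f)) := by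
  sorry

/-- H6.BC (M, the heart of Plan B = (★) chain-indexed): for the chain member `B = B_{f₀ q^j}` the local
embedding number is the depth-stratified unimodular count over the over-orders `B_{f₀ q^{j+d}}`, `d ≤ min e (a-j)`,
divided by `φ(q^e) [B_{f₀q^{j+d}}ˣ : Bˣ]_q = φ(q^e) · chainW q (q+1-ρ(B_{f₀q^{j+d}})) d`.
(Exact depth `d` = `depthLE (q^d) \ depthLE (q^{d-1})`, written with a difference of cards.) -/
theorem localEmbeddingNumber_eq_sum_depth {M p : ℕ} (S : XiSetup M p) (hM : M ≠ 0)
    {γ : S.D} {t : ℤ} {n : ℕ} (hγ : GammaHyp γ t n) (hn : n.Coprime M) (hqM : q ∣ M)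
    {F₀ a f₀ : ℕ} (C : Chain t n q F₀ a f₀) {j : ℕ} (hj : j ≤ a) :
    haveI : NeZero (q ^ M.factorization q) := ⟨pow_ne_zero _ hq.out.ne_zero⟩
    (localEmbeddingNumber S.O γ (ordOf γ t n (f₀ * q ^ j)) q : ℚ) =
      ∑ d ∈ range (min (M.factorization q) (a - j) + 1),
        (((depthLE (q ^ M.factorization q) (sigmaMatrix t n (f₀ * q ^ (j + d))) (q ^ d)).card : ℚ) -
            (if d = 0 then 0 else
              ((depthLE (q ^ M.factorization q) (sigmaMatrix t n (f₀ * q ^ (j + d))) (q ^ (d - 1))).card : ℚ))) /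
          ((Nat.totient (q ^ M.factorization q) : ℚ) *
            chainW q (q + 1 - rho q (tOf t n (f₀ * q ^ (j + d))) (nOf t n (f₀ * q ^ (j + d)))) d) := by
  sorry

/-! Kernel sanity of the finite currency (PROVED by `decide`): unit counts `#(R/4R)ˣ` for
`R = ℤ_2[ζ₃]` (inert, `ρ = 0`): 12 = 2²·1·3, and `R = ℤ_2[i]` (ramified, `ρ = 1`): 8 = 2²·1·2. -/
example : (Finset.univ.filter fun xy : ZMod 4 × ZMod 4 =>
    (xy.1 ^ 2 + xy.1 * xy.2 + xy.2 ^ 2) ∈ ({1, 3} : Finset (ZMod 4))).card = 12 := by decide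
example : (Finset.univ.filter fun xy : ZMod 4 × ZMod 4 =>
    (xy.1 ^ 2 + xy.2 ^ 2) ∈ ({1, 3} : Finset (ZMod 4))).card = 8 := by decide

end PlanB

end Summit.ABC.ABC.Cruxes.DefiniteRTControlPrime.StubIdeas3g6
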